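import Literature.NumberTheory.NumberFields.SqrtTwoTowerThreeOrderFourClassCertificate
import HarnessLib

/-!
# The Galois action on the three-step `√2`-tower `K ⊂ K₁ ⊂ K₂ ⊂ L` (`s₁² = 2`, `s₂² = 2 + s₁`, `s₃² = 2 + s₂`): a generator `σ` with `σ(s₃) = s₃³ − 3s₃`,
# its iterates on the generators, and the residue-symbol obstruction «`(q₀, s₃ − t) ≠ (1)`» computed in `𝓞_K`

`Proofs`-style file (theorems only: no definition, no named fact, no instance, no `sorry`) in topic `NumberTheory/NumberFields` (namespace = path),
written by the prover seat `bsd-line-att-p4` g43 (cell `bsd-f1-sign2`, route `AlignedTransportAtTwo`; `--supports` stmt-BirchSwinnertonDyer-22298, closes nothing).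
Companion of this seat's g41 file `SqrtTwoTowerThreeOrderFourClassCertificate` (coordinates `exists_coord8_of_tower`, uniqueness, product rule, `64·𝓞_L` has
`𝓞_K`-coordinates): there the class group of `L` was probed WITHOUT the Galois group; here the Galois group `Gal(L/K)` (order `8`) is made explicit, as needed by
RELATION certificates `∏ σ^i(𝔠)^{f_i} = (y)` (att-p3 g48/g49's relation doors `IwasawaTheory/ClassGroupPRankLeOfRelationTwo*`).

* `span_pair_mul_span_pair_eq_of_comax` — in any commutative ring: `a b + c z + d z' = 1 ⟹ (b, z)(b, z') = (b, z z')` (Dedekind's two-generator calculus).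
* ★ `algEquiv_eq_of_apply_eq_tower3` — `τ, τ' ∈ Gal(L/K)` with `τ s₃ = τ' s₃` are equal (`L = K(s₃)`: eight coordinates).
* ★★ `exists_algEquiv_apply_eq_tower3` — `L/K` Galois, `[K₁:K] = [K₂:K₁] = [L:K₂] = 2` ⟹ **there is `σ ∈ Gal(L/K)` with `σ(s₃) = s₃³ − 3s₃`** (the eight values `τ(s₃)`
  are eight distinct roots of `P = ((X²−2)²−2)²−2`, which has at most eight; `s₃³ − 3s₃` is one of them).  No cyclicity input.
* ★ `tower3_galois_iterates` — for such `σ`: `σ(s₁) = −s₁`, `σ(s₂) = s₁s₂ − s₂`, `σ(s₃) = s₂s₃ − s₃`, `σ²(s₃) = s₃ + s₁s₃ − s₁s₂s₃`, `σ³(s₃) = s₃ + s₁s₃ − s₂s₃`,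
  **`σ⁴(s₃) = −s₃`**, `σ⁵(s₃) = s₃ − s₂s₃` (`2cos(3·)`-iterates on `2cos(π/16)`-conjugates).
* ★★ `forall_mem_zpowers_of_apply_eq_tower3` — such `σ` has order `8` and **generates `Gal(L/K)`** (`σ⁴ ≠ 1` and `#Gal = 8`).
* ★★ `span_pair_ne_top_of_residue_tower3` — `q₀ ∈ 𝓞_K`, `t ∈ ℤ`, a ring map `ψ : 𝓞_K → ℤ/q` (`q > 1` odd) with `ψ(q₀) = 0` and `P(t) = 0` in `ℤ/q`
  ⟹ **the ideal `(q₀, s₃ − t)` of `𝓞_L` is proper** (the residue symbol of g41's file: `64·𝓞_L ⊆ Σ 𝓞_K b_i`, product rule, `ψ`; no prime of `𝓞_L` is constructed).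

HONEST SCOPE: elementary Galois theory and commutative algebra of the tower; nothing specific to any summit; no field is certified; BSD is not advanced here.

References: [NeukirchANT1999] Ch. I §2 (bases, conjugates), Ch. I §8 (residue fields of split primes), Ch. IV §1 (Galois groups of towers); [Washington1997] §13.1
(`ℚ_3 = ℚ(ζ₃₂)⁺ = ℚ(2cos(π/16))`, cyclic of order `8`); [Marcus2018] Ch. 3 Thm. 27; [Cohen1993] §4.7 (two-element representation of ideals), §6.5.
-/

set_option autoImplicit false

noncomputable section

open scoped NumberField nonZeroDivisors
open NumberField Module Polynomial

namespace Literature.NumberTheory.NumberFields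

/-! ## §0 Dedekind's two-generator calculus -/

section Algebra

variable {R : Type*} [CommRing R]

/-- **`(b, z)·(b, z') = (b, z z')` when `(b, z, z') = (1)`** (witness `a b + c z + d z' = 1`): `⊆` is clear, and `b = b(ab + cz + dz') ∈ (b,z)(b,z')`.
[cite: Cohen1993, §4.7 (operations on two-element representations)] -/
theorem span_pair_mul_span_pair_eq_of_comax {a b c d z z' : R} (h : a * b + c * z + d * z' = 1) :
    Ideal.span {b, z} * Ideal.span {b, z'} = Ideal.span {b, z * z'} := by
  apply le_antisymm
  · rw [Ideal.span_pair_mul_span_pair, Ideal.span_le]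
    intro x hx
    simp only [Set.mem_insert_iff, Set.mem_singleton_iff] at hx
    rcases hx with rfl | rfl | rfl | rfl
    · exact Ideal.mul_mem_left _ _ (Ideal.subset_span (by simp))
    · exact Ideal.mul_mem_right _ _ (Ideal.subset_span (by simp))
    · exact Ideal.mul_mem_left _ _ (Ideal.subset_span (by simp))
    · exact Ideal.subset_span (by simp)
  · rw [Ideal.span_le]
    intro x hx
    simp only [Set.mem_insert_iff, Set.mem_singleton_iff] at hx
    have hb : b ∈ Ideal.span {b, z} := Ideal.subset_span (by simp)
    have hb' : b ∈ Ideal.span {b, z'} := Ideal.subset_span (by simp)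
    have hz : z ∈ Ideal.span {b, z} := Ideal.subset_span (by simp)
    have hz' : z' ∈ Ideal.span {b, z'} := Ideal.subset_span (by simp)
    have key : a * (b * b) + c * (z * b) + d * (b * z') ∈ Ideal.span {b, z} * Ideal.span {b, z'} :=
      Ideal.add_mem _ (Ideal.add_mem _ (Ideal.mul_mem_left _ _ (Ideal.mul_mem_mul hb hb'))
        (Ideal.mul_mem_left _ _ (Ideal.mul_mem_mul hz hb'))) (Ideal.mul_mem_left _ _ (Ideal.mul_mem_mul hb hz'))
    rw [show a * (b * b) + c * (z * b) + d * (b * z') = b by linear_combination b * h] at key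
    rcases hx with rfl | rfl
    · exact key
    · exact Ideal.mul_mem_mul hz hz'

/-- `(b, x + b w) = (b, x)` (changing a generator modulo the other). [cite: Cohen1993, §4.7 (two-element representation of ideals)] -/
theorem span_pair_add_mul_eq (b x w : R) : Ideal.span {b, x + b * w} = Ideal.span {b, x} := by
  rw [show x + b * w = x + w * b by ring, Ideal.span_pair_add_mul_left]

end Algebra

/-! ## §1 The Galois group of the three-step tower: the automorphism `s₃ ↦ s₃³ − 3s₃` and its iterates -/

section Tower3Galois

variable {K K₁ K₂ L : Type*} [Field K] [Field K₁] [Field K₂] [Field L]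
  [Algebra K K₁] [Algebra K₁ K₂] [Algebra K K₂] [IsScalarTower K K₁ K₂]
  [Algebra K₂ L] [Algebra K L] [Algebra K₁ L] [IsScalarTower K K₂ L] [IsScalarTower K₁ K₂ L]

/-- ★ **An element of `Gal(L/K)` is determined by its value at `s₃`** (`s₂ = s₃² − 2`, `s₁ = s₂² − 2`, and every `z ∈ L` has `K`-coordinates on the eight
monomials). [cite: NeukirchANT1999, Ch. I §2] -/
theorem algEquiv_eq_of_apply_eq_tower3 (h1 : Module.finrank K K₁ = 2) (h2 : Module.finrank K₁ K₂ = 2) (h3 : Module.finrank K₂ L = 2)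
    {s₁ : K₁} (hs₁K : ∀ k : K, algebraMap K K₁ k ≠ s₁)
    {s₂ : K₂} (hs₂ : s₂ ^ 2 = algebraMap K₁ K₂ (2 + s₁)) (hs₂K : ∀ x : K₁, algebraMap K₁ K₂ x ≠ s₂)
    {s₃ : L} (hs₃ : s₃ ^ 2 = algebraMap K₂ L (2 + s₂)) (hs₃K : ∀ x : K₂, algebraMap K₂ L x ≠ s₃)
    {τ τ' : L ≃ₐ[K] L} (h : τ s₃ = τ' s₃) : τ = τ' := by
  have hS₂ : algebraMap K₂ L s₂ = s₃ ^ 2 - 2 := by rw [hs₃, map_add, map_ofNat]; ring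
  have hS₁ : algebraMap K₁ L s₁ = (algebraMap K₂ L s₂) ^ 2 - 2 := by
    rw [IsScalarTower.algebraMap_apply K₁ K₂ L, ← map_pow, hs₂, map_add, map_ofNat, map_add, map_ofNat]; ring
  have h₂ : τ (algebraMap K₂ L s₂) = τ' (algebraMap K₂ L s₂) := by
    rw [hS₂, map_sub, map_sub, map_pow, map_pow, h, map_ofNat, map_ofNat]
  have h₁ : τ (algebraMap K₁ L s₁) = τ' (algebraMap K₁ L s₁) := by
    rw [hS₁, map_sub, map_sub, map_pow, map_pow, h₂, map_ofNat, map_ofNat]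
  apply AlgEquiv.ext
  intro z
  obtain ⟨x₀, x₁, x₂, x₃, x₄, x₅, x₆, x₇, rfl⟩ := exists_coord8_of_tower h1 h2 h3 hs₁K hs₂K hs₃K z
  simp only [map_add, map_mul, AlgEquiv.commutes, h, h₁, h₂]

set_option maxHeartbeats 800000 in
/-- ★★ **The automorphism `s₃ ↦ s₃³ − 3s₃` exists.**  `L/K` Galois, `[K₁:K] = [K₂:K₁] = [L:K₂] = 2`, `s₁ ∉ K`, `s₂ ∉ K₁`, `s₃ ∉ K₂`: the map `τ ↦ τ(s₃)` is
injective on `Gal(L/K)` (eight elements) with values among the roots of `P = ((X²−2)²−2)²−2` (at most eight), so EVERY root of `P` in `L` is a `τ(s₃)`; and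
`P(s₃³ − 3s₃) = 0`. [cite: Washington1997, §13.1] [cite: NeukirchANT1999, Ch. IV §1] -/
theorem exists_algEquiv_apply_eq_tower3 [FiniteDimensional K L] [IsGalois K L]
    (h1 : Module.finrank K K₁ = 2) (h2 : Module.finrank K₁ K₂ = 2) (h3 : Module.finrank K₂ L = 2)
    {s₁ : K₁} (hs₁ : s₁ ^ 2 = 2) (hs₁K : ∀ k : K, algebraMap K K₁ k ≠ s₁)
    {s₂ : K₂} (hs₂ : s₂ ^ 2 = algebraMap K₁ K₂ (2 + s₁)) (hs₂K : ∀ x : K₁, algebraMap K₁ K₂ x ≠ s₂)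
    {s₃ : L} (hs₃ : s₃ ^ 2 = algebraMap K₂ L (2 + s₂)) (hs₃K : ∀ x : K₂, algebraMap K₂ L x ≠ s₃) :
    ∃ σ : L ≃ₐ[K] L, σ s₃ = s₃ ^ 3 - 3 * s₃ := by
  classical
  haveI : FiniteDimensional K K₂ := by
    haveI : FiniteDimensional K₂ L := Module.finite_of_finrank_pos (by rw [h3]; norm_num)
    exact FiniteDimensional.left K K₂ L
  haveI : FiniteDimensional K K₁ := Module.finite_of_finrank_pos (by rw [h1]; norm_num)
  haveI : FiniteDimensional K₁ K₂ := Module.finite_of_finrank_pos (by rw [h2]; norm_num)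
  haveI : FiniteDimensional K₂ L := Module.finite_of_finrank_pos (by rw [h3]; norm_num)
  set S₁ : L := algebraMap K₁ L s₁ with hS₁def
  set S₂ : L := algebraMap K₂ L s₂ with hS₂def
  have hS₁ : S₁ ^ 2 = 2 := by rw [hS₁def, ← map_pow, hs₁, map_ofNat]
  have hS₂ : S₂ ^ 2 = 2 + S₁ := by
    rw [hS₂def, hS₁def, ← map_pow, hs₂, IsScalarTower.algebraMap_apply K₁ K₂ L, map_add, map_ofNat, map_add, map_ofNat]
  have hS₃ : s₃ ^ 2 = 2 + S₂ := by rw [hs₃, map_add, map_ofNat]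
  -- `#Gal(L/K) = 8`
  have hcard : Nat.card (L ≃ₐ[K] L) = 8 := by
    rw [IsGalois.card_aut_eq_finrank, ← Module.finrank_mul_finrank K K₂ L, ← Module.finrank_mul_finrank K K₁ K₂, h1, h2, h3]
  -- the polynomial `P`
  set P : L[X] := ((X ^ 2 - C 2) ^ 2 - C 2) ^ 2 - C 2 with hP
  have hPdeg : P.natDegree = 8 := by rw [hP]; compute_degree!
  have hP0 : P ≠ 0 := by
    intro h0
    rw [h0, natDegree_zero] at hPdeg
    exact absurd hPdeg (by norm_num)
  have hevalP : ∀ x : L, P.eval x = ((x ^ 2 - 2) ^ 2 - 2) ^ 2 - 2 := fun x => by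
    simp only [hP, eval_sub, eval_pow, eval_X, eval_C]
  -- every `τ s₃` is a root of `P`
  have hτS₂ : ∀ τ : L ≃ₐ[K] L, τ S₂ = (τ s₃) ^ 2 - 2 := fun τ => by
    have : S₂ = s₃ ^ 2 - 2 := by rw [hS₃]; ring
    rw [this, map_sub, map_pow, map_ofNat]
  have hτS₁ : ∀ τ : L ≃ₐ[K] L, τ S₁ = (τ S₂) ^ 2 - 2 := fun τ => by
    have : S₁ = S₂ ^ 2 - 2 := by rw [hS₂]; ring
    rw [this, map_sub, map_pow, map_ofNat]
  have hroot : ∀ τ : L ≃ₐ[K] L, τ s₃ ∈ P.roots.toFinset := fun τ => by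
    rw [Multiset.mem_toFinset, mem_roots hP0, IsRoot.def, hevalP]
    have h := hτS₁ τ
    rw [hτS₂ τ] at h
    have hsq : (τ S₁) ^ 2 = 2 := by rw [← map_pow, hS₁, map_ofNat]
    rw [← h, hsq, sub_self]
  -- injectivity of `τ ↦ τ s₃` and counting
  have hinj : Function.Injective fun τ : L ≃ₐ[K] L => τ s₃ := fun τ τ' hττ' =>
    algEquiv_eq_of_apply_eq_tower3 h1 h2 h3 hs₁K hs₂ hs₂K hs₃ hs₃K hττ'
  have himg : Finset.univ.image (fun τ : L ≃ₐ[K] L => τ s₃) = P.roots.toFinset := by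
    apply Finset.eq_of_subset_of_card_le
    · intro x hx
      obtain ⟨τ, -, rfl⟩ := Finset.mem_image.mp hx
      exact hroot τ
    · rw [Finset.card_image_of_injective _ hinj, Finset.card_univ, ← Nat.card_eq_fintype_card, hcard]
      exact (Multiset.toFinset_card_le _).trans ((card_roots' P).trans hPdeg.le)
  -- `u = s₃³ − 3 s₃` is a root of `P`
  have hu : s₃ ^ 3 - 3 * s₃ ∈ P.roots.toFinset := by
    rw [Multiset.mem_toFinset, mem_roots hP0, IsRoot.def, hevalP]
    have hu2 : (s₃ ^ 3 - 3 * s₃) ^ 2 = 2 - S₂ + S₁ * S₂ := by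
      linear_combination (3 + S₁ + (-2) * S₂ + (-4) * s₃ ^ 2 + S₂ * s₃ ^ 2 + s₃ ^ 4) * hS₃ + ((-2) + s₃ ^ 2) * hS₂
    have hv2 : (S₁ * S₂ - S₂) ^ 2 - 2 = -S₁ := by
      linear_combination (1 + (-2) * S₁ + S₁ ^ 2) * hS₂ + (S₁) * hS₁
    rw [hu2, show 2 - S₂ + S₁ * S₂ - 2 = S₁ * S₂ - S₂ by ring, hv2, neg_sq, hS₁, sub_self]
  rw [← himg] at hu
  obtain ⟨σ, -, hσ⟩ := Finset.mem_image.mp hu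
  exact ⟨σ, hσ⟩

omit [Algebra K K₁] [Algebra K K₂] [IsScalarTower K K₁ K₂] [IsScalarTower K K₂ L] in
/-- ★ **The iterates of `σ` (`σ s₃ = s₃³ − 3s₃`) on the generators**: `σ s₁ = −s₁`, `σ s₂ = s₁s₂ − s₂`, `σ s₃ = s₂s₃ − s₃`, `σ²s₃ = s₃ + s₁s₃ − s₁s₂s₃`,
`σ³s₃ = s₃ + s₁s₃ − s₂s₃`, `σ⁴ s₃ = −s₃`, `σ⁵ s₃ = s₃ − s₂s₃`. [cite: Washington1997, §13.1 (`Gal(ℚ(ζ₃₂)⁺/ℚ)`: `ζ ↦ ζ³` generates)] -/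
theorem tower3_galois_iterates {s₁ : K₁} (hs₁ : s₁ ^ 2 = 2) {s₂ : K₂} (hs₂ : s₂ ^ 2 = algebraMap K₁ K₂ (2 + s₁))
    {s₃ : L} (hs₃ : s₃ ^ 2 = algebraMap K₂ L (2 + s₂)) {σ : L ≃ₐ[K] L} (hσ : σ s₃ = s₃ ^ 3 - 3 * s₃) :
    σ (algebraMap K₁ L s₁) = -algebraMap K₁ L s₁ ∧ σ (algebraMap K₂ L s₂) = algebraMap K₁ L s₁ * algebraMap K₂ L s₂ - algebraMap K₂ L s₂ ∧
      σ s₃ = algebraMap K₂ L s₂ * s₃ - s₃ ∧ (σ ^ 2) s₃ = s₃ + algebraMap K₁ L s₁ * s₃ - algebraMap K₁ L s₁ * algebraMap K₂ L s₂ * s₃ ∧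
      (σ ^ 3) s₃ = s₃ + algebraMap K₁ L s₁ * s₃ - algebraMap K₂ L s₂ * s₃ ∧ (σ ^ 4) s₃ = -s₃ ∧ (σ ^ 5) s₃ = s₃ - algebraMap K₂ L s₂ * s₃ := by
  set S₁ : L := algebraMap K₁ L s₁ with hS₁def
  set S₂ : L := algebraMap K₂ L s₂ with hS₂def
  have hS₁ : S₁ ^ 2 = 2 := by rw [hS₁def, ← map_pow, hs₁, map_ofNat]
  have hS₂ : S₂ ^ 2 = 2 + S₁ := by
    rw [hS₂def, hS₁def, ← map_pow, hs₂, IsScalarTower.algebraMap_apply K₁ K₂ L, map_add, map_ofNat, map_add, map_ofNat]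
  have hS₃ : s₃ ^ 2 = 2 + S₂ := by rw [hs₃, map_add, map_ofNat]
  have h1' : σ s₃ = S₂ * s₃ - s₃ := by rw [hσ]; linear_combination (s₃) * hS₃
  have h2' : σ S₂ = S₁ * S₂ - S₂ := by
    have : S₂ = s₃ ^ 2 - 2 := by rw [hS₃]; ring
    rw [congrArg σ this, map_sub, map_pow, map_ofNat, hσ]
    linear_combination (3 + S₁ + (-2) * S₂ + (-4) * s₃ ^ 2 + S₂ * s₃ ^ 2 + s₃ ^ 4) * hS₃ + ((-2) + s₃ ^ 2) * hS₂
  have h3' : σ S₁ = -S₁ := by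
    have : S₁ = S₂ ^ 2 - 2 := by rw [hS₂]; ring
    rw [congrArg σ this, map_sub, map_pow, map_ofNat, h2']
    linear_combination (1 + (-2) * S₁ + S₁ ^ 2) * hS₂ + (S₁) * hS₁
  have hp2 : (σ ^ 2) s₃ = s₃ + S₁ * s₃ - S₁ * S₂ * s₃ := by
    rw [pow_two, AlgEquiv.mul_apply, h1', map_sub, map_mul, h2', h1']
    linear_combination ((-1) * s₃ + S₁ * s₃) * hS₂ + (s₃) * hS₁
  have hp3 : (σ ^ 3) s₃ = s₃ + S₁ * s₃ - S₂ * s₃ := by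
    rw [pow_succ', AlgEquiv.mul_apply, hp2, map_sub, map_add, map_mul, map_mul, map_mul, h3', h2', h1']
    linear_combination ((-1) * S₁ * s₃ + S₁ ^ 2 * s₃) * hS₂ + (s₃ + S₁ * s₃ + (-1) * S₂ * s₃) * hS₁
  have hp4 : (σ ^ 4) s₃ = -s₃ := by
    rw [pow_succ', AlgEquiv.mul_apply, hp3, map_sub, map_add, map_mul, map_mul, h3', h2', h1']
    linear_combination (s₃ + (-1) * S₁ * s₃) * hS₂ + ((-1) * s₃) * hS₁
  have hp5 : (σ ^ 5) s₃ = s₃ - S₂ * s₃ := by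
    rw [pow_succ', AlgEquiv.mul_apply, hp4, map_neg, h1']; ring
  exact ⟨h3', h2', h1', hp2, hp3, hp4, hp5⟩

/-- ★★ **`σ` generates `Gal(L/K)`**: `σ⁴ s₃ = −s₃ ≠ s₃`, so `σ` has order `8 = #Gal(L/K)`. [cite: Washington1997, §13.1] [cite: NeukirchANT1999, Ch. IV §1] -/
theorem forall_mem_zpowers_of_apply_eq_tower3 [FiniteDimensional K L] [IsGalois K L]
    (h1 : Module.finrank K K₁ = 2) (h2 : Module.finrank K₁ K₂ = 2) (h3 : Module.finrank K₂ L = 2)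
    {s₁ : K₁} (hs₁ : s₁ ^ 2 = 2) (hs₁K : ∀ k : K, algebraMap K K₁ k ≠ s₁)
    {s₂ : K₂} (hs₂ : s₂ ^ 2 = algebraMap K₁ K₂ (2 + s₁)) (hs₂K : ∀ x : K₁, algebraMap K₁ K₂ x ≠ s₂)
    {s₃ : L} (hs₃ : s₃ ^ 2 = algebraMap K₂ L (2 + s₂)) {σ : L ≃ₐ[K] L} (hσ : σ s₃ = s₃ ^ 3 - 3 * s₃) :
    ∀ τ : L ≃ₐ[K] L, τ ∈ Subgroup.zpowers σ := by
  classical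
  haveI : FiniteDimensional K K₂ := by
    haveI : FiniteDimensional K₂ L := Module.finite_of_finrank_pos (by rw [h3]; norm_num)
    exact FiniteDimensional.left K K₂ L
  haveI : FiniteDimensional K K₁ := Module.finite_of_finrank_pos (by rw [h1]; norm_num)
  haveI : FiniteDimensional K₁ K₂ := Module.finite_of_finrank_pos (by rw [h2]; norm_num)
  have hcard : Nat.card (L ≃ₐ[K] L) = 8 := by
    rw [IsGalois.card_aut_eq_finrank, ← Module.finrank_mul_finrank K K₂ L, ← Module.finrank_mul_finrank K K₁ K₂, h1, h2, h3]
  have hs₃0 : s₃ ≠ 0 := by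
    intro h0
    have h22 : algebraMap K₂ L (2 + s₂) = 0 := by rw [← hs₃, h0]; ring
    rw [map_eq_zero_iff _ (algebraMap K₂ L).injective] at h22
    exact hs₂K (-2) (by rw [map_neg, map_ofNat]; linear_combination (-1) * h22)
  have h2ne : (2 : L) ≠ 0 := by
    intro h0
    have h0' : algebraMap K₁ L 2 = 0 := by rw [map_ofNat, h0]
    rw [map_eq_zero_iff _ (algebraMap K₁ L).injective] at h0'
    have hsq : s₁ ^ 2 = 0 := by rw [hs₁, h0']
    exact hs₁K 0 (by rw [map_zero]; exact (pow_eq_zero_iff two_ne_zero).mp hsq |>.symm)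
  have hp4 := (tower3_galois_iterates (K := K) hs₁ hs₂ hs₃ hσ).2.2.2.2.2.1
  have hne : σ ^ 4 ≠ 1 := by
    intro h
    rw [h, AlgEquiv.one_apply] at hp4
    have h2s : (2 : L) * s₃ = 0 := by linear_combination hp4
    exact hs₃0 ((mul_eq_zero.mp h2s).resolve_left h2ne)
  have hdvd : orderOf σ ∣ 2 ^ 3 := by
    have h := orderOf_dvd_natCard σ
    rw [hcard] at h
    exact h
  have hord : orderOf σ = 8 := by
    obtain ⟨k, hk, hk'⟩ := (Nat.dvd_prime_pow Nat.prime_two).mp hdvd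
    have hk4 : ¬ orderOf σ ∣ 4 := fun h4 => hne (orderOf_dvd_iff_pow_eq_one.mp h4)
    interval_cases k
    · exact absurd (by rw [hk']; norm_num) hk4
    · exact absurd (by rw [hk']; norm_num) hk4
    · exact absurd (by rw [hk']; norm_num) hk4
    · rw [hk']; norm_num
  have htop : Subgroup.zpowers σ = ⊤ := by
    apply Subgroup.eq_top_of_card_eq
    rw [Nat.card_zpowers, hord, hcard]
  intro τ
  rw [htop]
  exact Subgroup.mem_top τ

end Tower3Galois

/-! ## §2 The residue-symbol obstruction: `(q₀, s₃ − t)` is a proper ideal of `𝓞_L` -/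

section Residue3

variable {K K₁ K₂ L : Type*} [Field K] [Field K₁] [NumberField K₁] [Field K₂] [NumberField K₂] [Field L] [NumberField L]
  [Algebra K K₁] [Algebra K₁ K₂] [Algebra K K₂] [IsScalarTower K K₁ K₂]
  [Algebra K₂ L] [Algebra K L] [Algebra K₁ L] [IsScalarTower K K₂ L] [IsScalarTower K₁ K₂ L]
  [FiniteDimensional K K₁] [IsGalois K K₁] [FiniteDimensional K₁ K₂] [IsGalois K₁ K₂] [FiniteDimensional K₂ L] [IsGalois K₂ L]

set_option maxHeartbeats 800000 in
/-- ★★ **`(q₀, s₃ − t) ≠ (1)` in `𝓞_L` from a residue map of `𝓞_K`.**  `q₀ ∈ 𝓞_K`, `t ∈ ℤ`; `ψ : 𝓞_K → ℤ/q` a ring map (`q > 1`, `2` invertible) with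
`ψ(q₀) = 0` and `P(t) = ((t²−2)²−2)²−2 = 0` in `ℤ/q`.  If `u q₀ + v (s₃ − t) = 1` in `𝓞_L`, write `64u`, `64v` on the eight `𝓞_K`-coordinates
(`exists_sixtyfour_mul_eq_coord8_of_isIntegral`), expand `64 = (64u)q₀ + (64v)(s₃ − t)` by the product rule, compare coordinates, and apply the symbol
`x ↦ Σ ψ(x_i) rᵢ` (`r₃ = t`, `r₂ = t² − 2`, `r₁ = r₂² − 2`): the right side vanishes (`ψ(q₀) = 0`, `r₃ − t = 0`), the left is `64 ≠ 0`.  This is the degree-one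
prime `(ker ψ, s₁ − r₁, s₂ − r₂, s₃ − r₃)` above `(q₀)` witnessing properness, computed without constructing it.
[cite: NeukirchANT1999, Ch. I §8 (residue fields of split primes)] [cite: Marcus2018, Ch. 3, Thm. 27] -/
theorem span_pair_ne_top_of_residue_tower3 (h1 : Module.finrank K K₁ = 2) (h2 : Module.finrank K₁ K₂ = 2) (h3 : Module.finrank K₂ L = 2)
    {s₁ : K₁} (hs₁ : s₁ ^ 2 = 2) (hs₁K : ∀ k : K, algebraMap K K₁ k ≠ s₁)
    {s₂ : K₂} (hs₂ : s₂ ^ 2 = algebraMap K₁ K₂ (2 + s₁)) (hs₂K : ∀ x : K₁, algebraMap K₁ K₂ x ≠ s₂)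
    {s₃ : L} (hs₃ : s₃ ^ 2 = algebraMap K₂ L (2 + s₂)) (hs₃K : ∀ x : K₂, algebraMap K₂ L x ≠ s₃)
    (q₀ : 𝓞 K) (t : ℤ) {q : ℕ} (hq : 1 < q) (ψ : 𝓞 K →+* ZMod q) (hψ : ψ q₀ = 0) {ti : ZMod q} (hti : 2 * ti = 1)
    (hPt : (((t : ZMod q) ^ 2 - 2) ^ 2 - 2) ^ 2 - 2 = 0) {S₃ : 𝓞 L} (hS₃ : (S₃ : L) = s₃) :
    Ideal.span {algebraMap (𝓞 K) (𝓞 L) q₀, S₃ - t} ≠ ⊤ := by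
  intro htop
  rw [Ideal.eq_top_iff_one, Ideal.mem_span_pair] at htop
  obtain ⟨u, v, huv⟩ := htop
  have hcoe : ((algebraMap (𝓞 K) (𝓞 L) q₀ : 𝓞 L) : L) = algebraMap K L (q₀ : K) :=
    (IsScalarTower.algebraMap_apply (𝓞 K) (𝓞 L) L q₀).symm.trans (IsScalarTower.algebraMap_apply (𝓞 K) K L q₀)
  have huvL : (u : L) * algebraMap K L (q₀ : K) + (v : L) * (s₃ - t) = 1 := by
    have h := congrArg (fun z : 𝓞 L => (z : L)) huv
    simpa only [RingOfIntegers.coe_eq_algebraMap, map_add, map_mul, map_sub, map_one, map_intCast, ← hcoe, ← hS₃] using h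
  obtain ⟨a₀, a₁, a₂, a₃, a₄, a₅, a₆, a₇, ha⟩ := exists_sixtyfour_mul_eq_coord8_of_isIntegral h1 h2 h3 hs₁ hs₁K hs₂ hs₂K hs₃ hs₃K
    (z := (u : L)) (RingOfIntegers.isIntegral_coe u)
  obtain ⟨b₀, b₁, b₂, b₃, b₄, b₅, b₆, b₇, hb⟩ := exists_sixtyfour_mul_eq_coord8_of_isIntegral h1 h2 h3 hs₁ hs₁K hs₂ hs₂K hs₃ hs₃K
    (z := (v : L)) (RingOfIntegers.isIntegral_coe v)
  have hS₁ : (algebraMap K₁ L s₁) ^ 2 = 2 := by rw [← map_pow, hs₁, map_ofNat]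
  have hS₂ : (algebraMap K₂ L s₂) ^ 2 = 2 + algebraMap K₁ L s₁ := by
    rw [← map_pow, hs₂, IsScalarTower.algebraMap_apply K₁ K₂ L, map_add, map_ofNat, map_add, map_ofNat]
  have hS₃' : s₃ ^ 2 = 2 + algebraMap K₂ L s₂ := by rw [hs₃, map_add, map_ofNat]
  -- `64 = (64u) q₀ + (64v)(s₃ − t)`, expanded on the eight coordinates
  have h64 : algebraMap K L ((a₀ : K) * (q₀ : K) + (2 * (b₄ : K) + 2 * (b₆ : K) + 2 * (b₇ : K) - (b₀ : K) * t))
      + algebraMap K L ((a₁ : K) * (q₀ : K) + (2 * (b₅ : K) + (b₆ : K) + 2 * (b₇ : K) - (b₁ : K) * t)) * algebraMap K₁ L s₁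
      + (algebraMap K L ((a₂ : K) * (q₀ : K) + ((b₄ : K) + 2 * (b₆ : K) - (b₂ : K) * t))
        + algebraMap K L ((a₃ : K) * (q₀ : K) + ((b₅ : K) + 2 * (b₇ : K) - (b₃ : K) * t)) * algebraMap K₁ L s₁) * algebraMap K₂ L s₂
      + (algebraMap K L ((a₄ : K) * (q₀ : K) + ((b₀ : K) - (b₄ : K) * t)) + algebraMap K L ((a₅ : K) * (q₀ : K) + ((b₁ : K) - (b₅ : K) * t)) * algebraMap K₁ L s₁
        + (algebraMap K L ((a₆ : K) * (q₀ : K) + ((b₂ : K) - (b₆ : K) * t)) + algebraMap K L ((a₇ : K) * (q₀ : K) + ((b₃ : K) - (b₇ : K) * t)) * algebraMap K₁ L s₁)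
          * algebraMap K₂ L s₂) * s₃
      = algebraMap K L 64 + algebraMap K L 0 * algebraMap K₁ L s₁ + (algebraMap K L 0 + algebraMap K L 0 * algebraMap K₁ L s₁) * algebraMap K₂ L s₂
      + (algebraMap K L 0 + algebraMap K L 0 * algebraMap K₁ L s₁ + (algebraMap K L 0 + algebraMap K L 0 * algebraMap K₁ L s₁) * algebraMap K₂ L s₂) * s₃ := by
    have h := huvL
    have h64u := ha
    have h64v := hb
    simp only [map_add, map_mul, map_sub, map_ofNat, map_intCast, map_zero]
    linear_combination (64 : L) * h - algebraMap K L (q₀ : K) * h64u - (s₃ - (t : L)) * h64v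
      - (algebraMap K L (b₄ : K) + algebraMap K L (b₅ : K) * algebraMap K₁ L s₁ + algebraMap K L (b₆ : K) * algebraMap K₂ L s₂
          + algebraMap K L (b₇ : K) * algebraMap K₁ L s₁ * algebraMap K₂ L s₂) * hS₃'
      - (algebraMap K L (b₆ : K) + algebraMap K L (b₇ : K) * algebraMap K₁ L s₁) * hS₂ - (algebraMap K L (b₇ : K)) * hS₁
  obtain ⟨e₀, e₁, e₂, e₃, e₄, e₅, e₆, e₇⟩ := coord8_unique_of_tower hs₁K hs₂K hs₃K h64
  -- back to `𝓞_K`, then apply `ψ`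
  have f₀ : a₀ * q₀ + (2 * b₄ + 2 * b₆ + 2 * b₇ - b₀ * t) = 64 := by apply RingOfIntegers.coe_injective; push_cast; exact e₀
  have f₁ : a₁ * q₀ + (2 * b₅ + b₆ + 2 * b₇ - b₁ * t) = 0 := by apply RingOfIntegers.coe_injective; push_cast; exact e₁
  have f₂ : a₂ * q₀ + (b₄ + 2 * b₆ - b₂ * t) = 0 := by apply RingOfIntegers.coe_injective; push_cast; exact e₂
  have f₃ : a₃ * q₀ + (b₅ + 2 * b₇ - b₃ * t) = 0 := by apply RingOfIntegers.coe_injective; push_cast; exact e₃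
  have f₄ : a₄ * q₀ + (b₀ - b₄ * t) = 0 := by apply RingOfIntegers.coe_injective; push_cast; exact e₄
  have f₅ : a₅ * q₀ + (b₁ - b₅ * t) = 0 := by apply RingOfIntegers.coe_injective; push_cast; exact e₅
  have f₆ : a₆ * q₀ + (b₂ - b₆ * t) = 0 := by apply RingOfIntegers.coe_injective; push_cast; exact e₆
  have f₇ : a₇ * q₀ + (b₃ - b₇ * t) = 0 := by apply RingOfIntegers.coe_injective; push_cast; exact e₇
  have g₀ := congrArg ψ f₀
  have g₁ := congrArg ψ f₁
  have g₂ := congrArg ψ f₂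
  have g₃ := congrArg ψ f₃
  have g₄ := congrArg ψ f₄
  have g₅ := congrArg ψ f₅
  have g₆ := congrArg ψ f₆
  have g₇ := congrArg ψ f₇
  simp only [map_add, map_mul, map_sub, map_ofNat, map_intCast, map_zero] at g₀ g₁ g₂ g₃ g₄ g₅ g₆ g₇
  -- the symbol identity in `ℤ/q`
  set R₁ : ZMod q := ((t : ZMod q) ^ 2 - 2) ^ 2 - 2 with hR₁def
  have hR₁ : R₁ ^ 2 = 2 := by rw [hR₁def]; linear_combination hPt
  have hT4 : (t : ZMod q) ^ 4 = R₁ + 4 * (t : ZMod q) ^ 2 - 2 := by rw [hR₁def]; ring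
  have h64q : (64 : ZMod q) = 0 := by
    linear_combination ((-1)) * g₀ + ((-1) * R₁) * g₁ + (2 + (-1) * (t : ZMod q) ^ 2) * g₂ + (2 * R₁ + (-1) * R₁ * (t : ZMod q) ^ 2) * g₃
      + ((-1) * (t : ZMod q)) * g₄ + ((-1) * R₁ * (t : ZMod q)) * g₅ + (2 * (t : ZMod q) + (-1) * (t : ZMod q) ^ 3) * g₆
      + (2 * R₁ * (t : ZMod q) + (-1) * R₁ * (t : ZMod q) ^ 3) * g₇
      + (ψ a₀ + (-2) * ψ a₂ + ψ a₁ * R₁ + (-2) * ψ a₃ * R₁ + ψ a₄ * (t : ZMod q) + (-2) * ψ a₆ * (t : ZMod q) + ψ a₂ * (t : ZMod q) ^ 2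
          + ψ a₅ * R₁ * (t : ZMod q) + (-2) * ψ a₇ * R₁ * (t : ZMod q) + ψ a₃ * R₁ * (t : ZMod q) ^ 2 + ψ a₆ * (t : ZMod q) ^ 3
          + ψ a₇ * R₁ * (t : ZMod q) ^ 3) * hψ
      + ((-1) * ψ b₇) * hR₁ + ((-1) * ψ b₆ + (-1) * ψ b₇ * R₁) * hT4
  haveI : Nontrivial (ZMod q) := ZMod.nontrivial_iff.mpr (by omega)
  have h1 : (1 : ZMod q) = 0 := by
    linear_combination (ti ^ 6) * h64q - (1 + 2 * ti + 4 * ti ^ 2 + 8 * ti ^ 3 + 16 * ti ^ 4 + 32 * ti ^ 5) * hti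
  exact one_ne_zero h1

end Residue3

end Literature.NumberTheory.NumberFields

end
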